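import Summits.BirchSwinnertonDyer.BirchSwinnertonDyer.Theorems.GenusKolyvaginAtTwoShaCardDvdPowAtTwoPosTSharpExponentRatOfRegularPairSupply
import HarnessLib

/-!
# Route `GenusKolyvaginAtTwo`, crux U⁺_T `ShaCardDvdPowAtTwoPosT` (stmt-BirchSwinnertonDyer-23378) — (B2Q±) corollaries: `2^{M₀} · Ш(E/ℚ)[2^∞] = 0`
# modulo the regular signed pair-Čebotarev supply, and the `Δ < 0` INSTANCE of that supply (so g22's B2Q is recovered — checked, not re-landed)

Seat `bsd-line-gk2-p5` g31 (WIDTH-5 attach, cell `bsd-f1-sign2`), `--supports stmt-BirchSwinnertonDyer-23378 --as helper` (closes nothing).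
THEOREMS ONLY (no definition, no named fact, no `sorry`).  BSD is NOT proved by any of this; neither is U⁺_T nor any stub.

Companion of `…PosTSharpExponentRatOfRegularPairSupply` (`two_pow_smul_selmer_rat_eq_zero_of_regularPairSupply`: Kolyvagin's B₂ at `2` over `ℚ`,
sharp, either sign of `Δ`, modulo the displayed hypothesis `hPair`):
* `two_pow_M0_smul_eq_zero_of_mem_sha_rat_of_regularPairSupply` — `2^{M₀} · Ш(E/ℚ)[2^∞] = 0` modulo `hPair`;
* `regularPairSupply_of_Δ_neg` — **on `Δ(E) < 0` the hypothesis `hPair` HOLDS** (gk2-p2's `infinite_kolyvaginPrime_localization_fullOrder_pair`: a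
  `Frob ℓ = Frob ∞` prime; its Frobenius acts on `E[2^{n+1}]` as a complex conjugation `c₀`, an involution moving a `2`-torsion point by Q1
  `KolyvaginEigenTwo.exists_twoTorsion_smul_ne_of_Δ_neg`) — so `hPair` is a faithful generalisation of the `Δ < 0` input, and what LINE 16_T must
  supply on `Δ > 0` is exactly its regular-Frobenius twin;
* consistency (kernel-checked in the seat's scratch, NOT re-landed — `dedup.landed`): g22's `two_pow_smul_selmer_rat_eq_zero_onHabitat` is
  `two_pow_smul_selmer_rat_eq_zero_of_regularPairSupply … (regularPairSupply_of_Δ_neg W hcm hneg K hIQ hsq1 hρ) …` verbatim;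
* adapters from the output shape of `regularKolyvaginSupplyAtTwo_proof` (a Frobenius `h` acting on `E[2^{n+1}]` as `h₀ = c₀ · res ρ` with
  `h₀² = 1` and the lossless witness `2^n • (P + h₀ • P) ≠ 0`) to the clauses of `hPair`: `smul_smul_eq_self_of_smul_eq` (involution) and
  `exists_smul_ne_twoTorsion_of_regular_witness` (a moved `2`-torsion point); the full-order clause is this namespace's
  `pow_zsmul_mem_iff_of_socle_not_mem`, the index clause `Zhang2014.le_kolyvaginIndex_iff` — so the regular SIGNED pair-Čebotarev in that shape
  (gk2-p4 g23, in progress) discharges `hPair` by a short script.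

References: [Kolyvagin1989Izv] Thm. B₂, §3; [McCallumLMS1991] §3 Cor. 3.2, §5 Lemma 5.3; [GrossLMS1991] §3 (3.1)–(3.3); [SilvermanAEC2009] X.4.2(a).
-/

set_option autoImplicit false
-- the Theorems namespace of this sub repeats the summit name by design (D-0017 nested layout)
set_option linter.dupNamespace false

noncomputable section

open scoped Classical
open scoped AddSubgroup

namespace Summit.BirchSwinnertonDyer.BirchSwinnertonDyer.Theorems.GenusExact.PlusDescent

open WeierstrassCurve NumberField IsDedekindDomain Field Rat.HeightOneSpectrum Literature.NumberTheory.EllipticCurves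
  Literature.NumberTheory.GaloisRepresentations Literature.NumberTheory.EllipticCurves.ModularForms AddSubgroup
  Literature.NumberTheory.EllipticCurves.RingClassField
open Summit.BirchSwinnertonDyer.BirchSwinnertonDyer.Theses.GenusKolyvaginAtTwo (KolyvaginRelationAtTwo)
open Summit.BirchSwinnertonDyer.Rank1Residual
open Summit.BirchSwinnertonDyer.BirchSwinnertonDyer.Theorems.GenusExact

/-- **Corollary: `2^{M₀} · Ш(E/ℚ)[2^∞] = 0`, either sign of `Δ`, modulo `hPair`** — every class of `Ш(E/ℚ)` killed by a power of `2` is killed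
by `2^{M₀}` (`Sel_(2^k)(E/ℚ) ↠ Ш(E/ℚ)[2^k]`, tree `map_torsionH1ToH1_selmerGroup_holds`, and `two_pow_smul_selmer_rat_eq_zero_of_regularPairSupply`).
(Adapted from `…RTSharpExponentRat.two_pow_M0_smul_eq_zero_of_mem_sha_rat_onHabitat`, gk2-p4 g22.) [cite: Kolyvagin1989Izv, Thm. B₂]
[cite: McCallumLMS1991, §1 Theorem] [cite: SilvermanAEC2009, Thm. X.4.2(a)] -/
theorem two_pow_M0_smul_eq_zero_of_mem_sha_rat_of_regularPairSupply (hQ2 : KolyvaginRelationAtTwo)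
    (W : WeierstrassCurve ℚ) [W.IsElliptic] [W.IsGloballyMinimal] [NeZero (W.conductorNorm ℤ)] (hcm : ¬ W.HasCM)
    (hT : Odd W.tamagawaProduct) (v : HeightOneSpectrum (𝓞 ℚ)) (h2v : ((2 : ℕ) : 𝓞 ℚ) ∉ v.asIdeal)
    (hNv : ((W.conductorNorm ℤ : ℕ) : 𝓞 ℚ) ∈ v.asIdeal) (hmult : W.HasMultiplicativeReductionAt v)
    (K : Type) [Field K] [NumberField K] (hIQ : IsImaginaryQuadratic K) (hodd : Odd (NumberField.discr K))
    (h3 : NumberField.discr K ≠ -3) (hHe : SatisfiesHeegnerHypothesis (W.conductorNorm ℤ) K)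
    (hsq1 : ¬ IsSquare ((NumberField.discr K : ℚ) * -|W.Δ|)) (hsq2 : ¬ IsSquare ((NumberField.discr K : ℚ) * (-(2 * |W.Δ|))))
    (hρ : ∀ n : ℕ, 0 < n → W.HasSurjectiveModNGaloisRep ((2 : ℤ) ^ n))
    (Dt : ModularParametrizationData W (W.conductorNorm ℤ)) (β : ℤ) (ι : K →+* ℂ) (d₁ : KolyvaginHeegnerData Dt β ι 1) (M₀ : ℕ)
    (hndiv : ¬ ∃ Q : (W.baseChange (ringClassField K ι 1)).toAffine.Point, ((2 ^ (M₀ + 1) : ℕ) : ℤ) • Q = d₁.derivedPoint)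
    (hw1 : W.rootNumber = 1)
    (hPair : ∀ (n : ℕ) (c : K ≃ₐ[ℚ] K), c ≠ 1 →
      ∀ (x y : galH1Torsion (W.baseChange K) ((2 ^ (n + 1) : ℕ) : ℤ)) (ex ey : ℕ), 1 ≤ ex → 1 ≤ ey →
      addOrderOf x = 2 ^ ex → addOrderOf y = 2 ^ ey →
      ∀ (sx sy : ℤ), (sx = 1 ∨ sx = -1) → (sy = 1 ∨ sy = -1) →
      conjAct W c ((2 ^ (n + 1) : ℕ) : ℤ) x = sx • x → conjAct W c ((2 ^ (n + 1) : ℕ) : ℤ) y = sy • y →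
      (∀ a b : ℤ, (∀ ρ ∈ torsionFixing (W.baseChange K) ((2 ^ (n + 1) : ℕ) : ℤ),
          h1Eval (W.baseChange K) ((2 ^ (n + 1) : ℕ) : ℤ) (a • x + b • y) ρ = 0) → a • x + b • y = 0) →
      ∃ ℓ : ℕ, Zhang2014.IsKolyvaginPrime (W.conductorNorm ℤ) W K 2 ℓ ∧ n + 1 ≤ Zhang2014.kolyvaginIndex W 2 ℓ ∧
        (∃ (v : HeightOneSpectrum (𝓞 ℚ)) (𝔓 : Ideal (absIntegers (𝓞 ℚ) ℚ)) (h c₀ : absoluteGaloisGroup ℚ),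
          (ℓ : 𝓞 ℚ) ∈ v.asIdeal ∧ 𝔓 ∈ v.primesAbove ∧ IsArithFrobAt (𝓞 ℚ) h 𝔓 ∧ IsComplexConjugation (Rat.castHom ℝ) c₀ ∧
          (∀ X : geomTorsion W ((2 ^ (n + 1) : ℕ) : ℤ), h • h • X = X) ∧
          (∃ u : geomTorsion W ((2 : ℕ) : ℤ), h • u ≠ u) ∧
          ∀ (e : K →ₐ[ℚ] AlgebraicClosure ℚ) (z : K), h • e z = c₀ • e z) ∧
        ∀ w : HeightOneSpectrum (𝓞 K), (ℓ : 𝓞 K) ∈ w.asIdeal →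
          (∀ j : ℕ, ((2 ^ j : ℕ) : ℤ) • x ∈ (W.baseChange K).torsionLocalKer (w.adicCompletion K) ((2 ^ (n + 1) : ℕ) : ℤ) ↔ ex ≤ j) ∧
          (∀ j : ℕ, ((2 ^ j : ℕ) : ℤ) • y ∈ (W.baseChange K).torsionLocalKer (w.adicCompletion K) ((2 ^ (n + 1) : ℕ) : ℤ) ↔ ey ≤ j))
    (k : ℕ) (a : W.galH1) (ha : a ∈ W.sha) (hka : ((2 ^ k : ℕ) : ℤ) • a = 0) :
    ((2 ^ M₀ : ℕ) : ℤ) • a = 0 := by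
  rcases Nat.eq_zero_or_pos k with rfl | hkpos
  · rw [pow_zero, Nat.cast_one, one_zsmul] at hka
    rw [hka, zsmul_zero]
  · have hn : ((2 ^ k : ℕ) : ℤ) ≠ 0 := by positivity
    have hmem : a ∈ W.sha ⊓ torsionBy W.galH1 ((2 ^ k : ℕ) : ℤ) :=
      AddSubgroup.mem_inf.mpr ⟨ha, by change ((2 ^ k : ℕ) : ℤ) • a = 0; exact hka⟩
    rw [← WeierstrassCurve.map_torsionH1ToH1_selmerGroup_holds W hn] at hmem
    obtain ⟨x, hx, rfl⟩ := AddSubgroup.mem_map.mp hmem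
    rw [← map_zsmul, two_pow_smul_selmer_rat_eq_zero_of_regularPairSupply hQ2 W hcm hT v h2v hNv hmult K hIQ hodd h3 hHe hsq1 hsq2 hρ Dt β ι
      d₁ M₀ hndiv hw1 hPair k x hx, map_zero]

/-! ## The `Δ < 0` instance: `hPair` HOLDS there with `h = c₀` (gk2-p2's pair theorem + Q1), and g22's (B2Q) is recovered -/

/-- **On `Δ(E) < 0` the regular signed pair-Čebotarev supply HOLDS**: gk2-p2's `infinite_kolyvaginPrime_localization_fullOrder_pair` (a
`Frob ℓ = Frob ∞` prime of index `≥ n+1` with full local orders for the eigenpair) — its Frobenius acts on `E[2^{n+1}]` as a complex conjugation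
`c₀`, which is an involution (`c₀² = 1`) MOVING a `2`-torsion point on `Δ < 0` (Q1, `KolyvaginEigenTwo.exists_twoTorsion_smul_ne_of_Δ_neg`).
[cite: McCallumLMS1991, §3 Cor. 3.2] [cite: GrossLMS1991, §3 (3.1)–(3.3)] -/
theorem regularPairSupply_of_Δ_neg (W : WeierstrassCurve ℚ) [W.IsElliptic] [W.IsGloballyMinimal] [NeZero (W.conductorNorm ℤ)]
    (hcm : ¬ W.HasCM) (hneg : W.Δ < 0) (K : Type) [Field K] [NumberField K] (hIQ : IsImaginaryQuadratic K)
    (hsq1 : ¬ IsSquare ((NumberField.discr K : ℚ) * -|W.Δ|)) (hρ : ∀ n : ℕ, 0 < n → W.HasSurjectiveModNGaloisRep ((2 : ℤ) ^ n)) :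
    ∀ (n : ℕ) (c : K ≃ₐ[ℚ] K), c ≠ 1 →
      ∀ (x y : galH1Torsion (W.baseChange K) ((2 ^ (n + 1) : ℕ) : ℤ)) (ex ey : ℕ), 1 ≤ ex → 1 ≤ ey →
      addOrderOf x = 2 ^ ex → addOrderOf y = 2 ^ ey →
      ∀ (sx sy : ℤ), (sx = 1 ∨ sx = -1) → (sy = 1 ∨ sy = -1) →
      conjAct W c ((2 ^ (n + 1) : ℕ) : ℤ) x = sx • x → conjAct W c ((2 ^ (n + 1) : ℕ) : ℤ) y = sy • y →
      (∀ a b : ℤ, (∀ ρ ∈ torsionFixing (W.baseChange K) ((2 ^ (n + 1) : ℕ) : ℤ),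
          h1Eval (W.baseChange K) ((2 ^ (n + 1) : ℕ) : ℤ) (a • x + b • y) ρ = 0) → a • x + b • y = 0) →
      ∃ ℓ : ℕ, Zhang2014.IsKolyvaginPrime (W.conductorNorm ℤ) W K 2 ℓ ∧ n + 1 ≤ Zhang2014.kolyvaginIndex W 2 ℓ ∧
        (∃ (v : HeightOneSpectrum (𝓞 ℚ)) (𝔓 : Ideal (absIntegers (𝓞 ℚ) ℚ)) (h c₀ : absoluteGaloisGroup ℚ),
          (ℓ : 𝓞 ℚ) ∈ v.asIdeal ∧ 𝔓 ∈ v.primesAbove ∧ IsArithFrobAt (𝓞 ℚ) h 𝔓 ∧ IsComplexConjugation (Rat.castHom ℝ) c₀ ∧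
          (∀ X : geomTorsion W ((2 ^ (n + 1) : ℕ) : ℤ), h • h • X = X) ∧
          (∃ u : geomTorsion W ((2 : ℕ) : ℤ), h • u ≠ u) ∧
          ∀ (e : K →ₐ[ℚ] AlgebraicClosure ℚ) (z : K), h • e z = c₀ • e z) ∧
        ∀ w : HeightOneSpectrum (𝓞 K), (ℓ : 𝓞 K) ∈ w.asIdeal →
          (∀ j : ℕ, ((2 ^ j : ℕ) : ℤ) • x ∈ (W.baseChange K).torsionLocalKer (w.adicCompletion K) ((2 ^ (n + 1) : ℕ) : ℤ) ↔ ex ≤ j) ∧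
          (∀ j : ℕ, ((2 ^ j : ℕ) : ℤ) • y ∈ (W.baseChange K).torsionLocalKer (w.adicCompletion K) ((2 ^ (n + 1) : ℕ) : ℤ) ↔ ey ≤ j) := by
  intro n c hc x y ex ey hex hey hx hy sx sy hsx hsy hτx hτy hres
  have hsurN : ∀ m : ℕ, W.HasSurjectiveModNGaloisRep ((2 ^ m : ℕ) : ℤ) :=
    MinimalTwinBSDTwo.forall_hasSurjectiveModNGaloisRep_two_pow_of_pos W hρ
  have hρN : ∀ m : ℕ, W.HasSurjectiveModNGaloisRep (2 ^ m : ℕ) := fun m ↦ by exact_mod_cast hsurN m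
  have hinf := infinite_kolyvaginPrime_localization_fullOrder_pair (W.conductorNorm ℤ) W hcm hneg K hIQ hsq1 hρN c hc (n + 1)
    (Nat.succ_pos n) x y hex hey hx hy hsx hsy hτx hτy hres
  obtain ⟨ℓ, hF, hkolZ, hidx, hloc⟩ := hinf.nonempty
  refine ⟨ℓ, hkolZ, hidx, ?_, hloc⟩
  obtain ⟨v, 𝔓, h, c₀, hℓv, h𝔓, hh, hc₀, hhP, hhK⟩ := hF
  obtain ⟨u, hu⟩ := KolyvaginEigenTwo.exists_twoTorsion_smul_ne_of_Δ_neg W hneg hc₀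
  refine ⟨v, 𝔓, h, c₀, hℓv, h𝔓, hh, hc₀, fun X ↦ ?_, ?_, hhK⟩
  · rw [hhP, hhP, ← mul_smul, ← pow_two, hc₀.sq_eq_one, one_smul]
  · -- the moved `2`-torsion point lies in `E[2^(n+1)]`, where `h = c₀`
    have hu2 : (u : geomPoints W) ∈ geomTorsion W ((2 : ℕ) : ℤ) := by
      rw [mem_geomTorsion_iff]
      have h2 := (mem_geomTorsion_iff W _ (u : geomPoints W)).mp u.2
      exact_mod_cast h2
    have huq : (u : geomPoints W) ∈ geomTorsion W ((2 ^ (n + 1) : ℕ) : ℤ) :=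
      geomTorsion_le_of_dvd W (by exact_mod_cast dvd_pow_self 2 (Nat.succ_ne_zero n)) hu2
    refine ⟨⟨u, hu2⟩, fun heq ↦ hu ?_⟩
    have h1 := congrArg Subtype.val heq
    have h2 := congrArg Subtype.val (hhP ⟨u, huq⟩)
    simp only [Literature.NumberTheory.EllipticCurves.AddSubgroup.torsionBy.coe_smul] at h1 h2
    apply Subtype.ext
    simp only [Literature.NumberTheory.EllipticCurves.AddSubgroup.torsionBy.coe_smul]
    rw [← h2]
    exact h1

/-! ## Adapters from the supply shape of `regularKolyvaginSupplyAtTwo_proof` (`h = c₀ · res ρ` on `E[2^{n+1}]`, regularity witness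
`2^n • (P + h₀ • P) ≠ 0`) to the clauses of `hPair` (involution, moved `2`-torsion point); the full-order clause is
`pow_zsmul_mem_iff_of_socle_not_mem`, the index clause `Zhang2014.le_kolyvaginIndex_iff`. -/

/-- A Frobenius acting on `E[m]` as an involution `h₀` is an involution of `E[m]`. [folklore] -/
theorem smul_smul_eq_self_of_smul_eq (W : WeierstrassCurve ℚ) {m : ℤ} {h h₀ : absoluteGaloisGroup ℚ}
    (hE : ∀ P : geomTorsion W m, h • P = h₀ • P) (hsq : ∀ X : geomTorsion W m, h₀ • h₀ • X = X) (X : geomTorsion W m) :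
    h • h • X = X := by
  rw [hE, hE, hsq]

/-- **The regularity witness gives a moved `2`-torsion point**: if `h` acts on `E[2^{n+1}]` as `h₀` and `2^n • (P + h₀ • P) ≠ 0` for some
`P ∈ E[2^{n+1}]` (the LOSSLESS clause of the regular supply), then `u := 2^n • P ∈ E[2]` has `h • u ≠ u` (else
`2^n • (P + h₀ P) = 2^{n+1} • P = 0`). [cite: McCallumLMS1991, §3 Cor. 3.2] -/
theorem exists_smul_ne_twoTorsion_of_regular_witness (W : WeierstrassCurve ℚ) {n : ℕ} {h h₀ : absoluteGaloisGroup ℚ}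
    (hE : ∀ P : geomTorsion W ((2 ^ (n + 1) : ℕ) : ℤ), h • P = h₀ • P)
    (hreg : ∃ P : geomTorsion W ((2 ^ (n + 1) : ℕ) : ℤ), (2 : ℤ) ^ n • (P + h₀ • P) ≠ 0) :
    ∃ u : geomTorsion W ((2 : ℕ) : ℤ), h • u ≠ u := by
  obtain ⟨P, hP⟩ := hreg
  have hP2 : ((2 ^ (n + 1) : ℕ) : ℤ) • (P : geomPoints W) = 0 := (mem_geomTorsion_iff W _ _).mp P.2
  have hmem : (2 : ℤ) ^ n • (P : geomPoints W) ∈ geomTorsion W ((2 : ℕ) : ℤ) := by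
    rw [mem_geomTorsion_iff, smul_smul]
    have e : (((2 : ℕ) : ℤ) * (2 : ℤ) ^ n) = ((2 ^ (n + 1) : ℕ) : ℤ) := by push_cast; ring
    rw [e, hP2]
  refine ⟨⟨_, hmem⟩, fun heq ↦ hP ?_⟩
  have h1 := congrArg Subtype.val heq
  have h2 := congrArg Subtype.val (hE P)
  simp only [Literature.NumberTheory.EllipticCurves.AddSubgroup.torsionBy.coe_smul] at h1 h2
  -- `h1 : h • (2^n • ↑P) = 2^n • ↑P`, `h2 : h • ↑P = h₀ • ↑P`
  apply Subtype.ext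
  simp only [AddSubgroup.coe_add, Literature.NumberTheory.EllipticCurves.AddSubgroup.torsionBy.coe_smul, ZeroMemClass.coe_zero]
  rw [← h2, smul_add, ← smul_comm h ((2 : ℤ) ^ n) (P : geomPoints W), h1, ← add_zsmul]
  have e : ((2 : ℤ) ^ n + (2 : ℤ) ^ n) = ((2 ^ (n + 1) : ℕ) : ℤ) := by push_cast; ring
  rw [e, hP2]

end Summit.BirchSwinnertonDyer.BirchSwinnertonDyer.Theorems.GenusExact.PlusDescent

end
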